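import Mathlib.Tactic
import HarnessLib
import HarnessLib.Audit.Tags
import Summits.CriticalPhenomena.PercolationContinuityZ3.Theorems.PercNearOneGluingNoHeavyLowerTailSahiAntichainSixBlowup
import Summits.CriticalPhenomena.PercolationContinuityZ3.Theorems.PercNearOneGluingNoHeavyLowerTailSahiAntichainSplitSeven
import Summits.CriticalPhenomena.PercolationContinuityZ3.Theorems.PercNearOneGluingNoHeavyLowerTailSahiAntichainSplitTwoTwo

/-!
# Antichains have many meets or many joins: `AntichainMeetsOrJoins` and the rainbow lemma for antichains

Support file (seat `prim-masterthm-p1`, gen 38; `--supports stmt-CriticalPhenomena-4575`).  No `sorry`, no new definitions, standard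
axioms.  Memo `run/shared/lean/prim/prim-masterthm/FROM-prim-masterthm-p1-g38-BLOWUP-SIDE.md` §6.

MAIN RESULTS ([this work], gen 38).
* `antichainMeetsOrJoins_holds` — the typed conjecture `AntichainMeetsOrJoins` (`…SahiRainbowIsolated`, gen 34) is a THEOREM: for a
  complement-free antichain `P ⊆ 2^F`, `#P ≤ #({∅} ∪ meets P)` or `#P ≤ #({F} ∪ joins P)`.  Proof: by V5 (`two_mul_card_le_add_two`),
  failure of both forces `#meets P = #joins P = #P − 1` with `∅ ∈ meets P` and `F ∈ joins P`; the equality `f = 2 #P − 2` leaves only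
  `#P = 2` (a complementary pair) and `#P = 6`, where the structure theorem (`exists_blowup_of_six`) gives a `C([4],2)` blow-up with empty
  common part and ground `⋃ B`, whose members `B i ∪ B j`, `B k ∪ B l` with `{i,j,k,l}` all distinct are complementary — excluded.
* `card_le_card_rainbowMeets_of_antichain` — the RAINBOW LEMMA for complement-free antichains: `#P ≤ #rainbowMeets F P`.
HONEST FRAMING: unconditional theorems; the rainbow lemma for general complement-free families (`RainbowMeetCojoin`, `IsolatedRainbow`) remains OPEN. [this work]
-/

namespace Summit.CriticalPhenomena.PercolationContinuityZ3.Theorems.SahiColouredDaykin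

open Finset

variable {α : Type*} [DecidableEq α]

/-- **The boundary case at six members.**  A complement-free six-member antichain inside `F` with at most eleven labels cannot have both a
disjoint pair and a pair covering `F`. [this work] -/
theorem not_empty_top_of_six {F : Finset α} {P : Finset (Finset α)} (hPF : ∀ S ∈ P, S ⊆ F) (hcf : ∀ S ∈ P, F \ S ∉ P)
    (hanti : IsAntichain (· ⊆ ·) (P : Set (Finset α))) (h6 : #P = 6) (hf : #(meets P) + #(joins P) ≤ 11)
    (h0 : (∅ : Finset α) ∈ meets P) (hF : F ∈ joins P) : False := by
  have h3 : ∀ s ∈ effPoints P, #(above P s) = 3 := fun s hs => (card_above_eq_three_of_six_le_eleven hanti h6 hf hs).1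
  have hS : ∀ s ∈ effPoints P, ∃ M, ∀ a ∈ above P s, ∀ a' ∈ above P s, a ≠ a' → a ∩ a' = M :=
    fun s hs => exists_inter_eq_above_of_six_le_eleven hanti h6 hf hs
  obtain ⟨K, B, hne, hKB, hdis, hA, _⟩ := exists_blowup_of_six hanti h6 h3 hS
  -- a disjoint pair: `K = ∅` and the two index pairs are disjoint
  obtain ⟨a, ha, b, hb, hab, he⟩ := mem_meets_iff.1 h0
  obtain ⟨i, j, hij, rfl⟩ := (hA a).1 ha
  obtain ⟨k, l, hkl, rfl⟩ := (hA b).1 hb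
  have hK : K = ∅ := by
    apply eq_empty_of_forall_notMem; intro x hx
    have : x ∈ (K ∪ B i ∪ B j) ∩ (K ∪ B k ∪ B l) :=
      mem_inter.2 ⟨mem_blowup_member_of_mem_K hx, mem_blowup_member_of_mem_K hx⟩
    rw [← he] at this; exact notMem_empty _ this
  have apart : ∀ {m : Fin 4}, (m = i ∨ m = j) → (m = k ∨ m = l) → False := by
    intro m h1 h2
    obtain ⟨x, hx⟩ := hne m
    have : x ∈ (K ∪ B i ∪ B j) ∩ (K ∪ B k ∪ B l) :=
      mem_inter.2 ⟨(mem_blowup_member_iff hdis hKB hx).2 h1, (mem_blowup_member_iff hdis hKB hx).2 h2⟩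
    rw [← he] at this; exact notMem_empty _ this
  -- a covering pair: every point of `F` lies in a block
  obtain ⟨c, hc, d, hd, _, hcd⟩ := mem_joins_iff.1 hF
  have blockpt : ∀ x ∈ F, ∃ m, x ∈ B m := by
    intro x hx
    have memblk : ∀ {g : Finset α}, g ∈ P → x ∈ g → ∃ m, x ∈ B m := by
      intro g hg hxg
      obtain ⟨m, m', _, rfl⟩ := (hA g).1 hg
      rcases mem_union.1 hxg with h | h
      · rcases mem_union.1 h with h | h
        · rw [hK] at h; exact absurd h (notMem_empty _)
        · exact ⟨m, h⟩
      · exact ⟨m', h⟩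
    rw [hcd] at hx
    rcases mem_union.1 hx with h | h
    · exact memblk hc h
    · exact memblk hd h
  -- the complement of `K ∪ B i ∪ B j` in `F` is `K ∪ B k ∪ B l`
  apply hcf _ ha
  have heq : F \ (K ∪ B i ∪ B j) = K ∪ B k ∪ B l := by
    ext x
    rw [mem_sdiff]
    constructor
    · rintro ⟨hxF, hxa⟩
      obtain ⟨m, hxm⟩ := blockpt x hxF
      have hmi : ¬ (m = i ∨ m = j) := fun h => hxa ((mem_blowup_member_iff hdis hKB hxm).2 h)
      have hik : i ≠ k := fun h => apart (Or.inl rfl) (Or.inl h)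
      have hil : i ≠ l := fun h => apart (Or.inl rfl) (Or.inr h)
      have hjk : j ≠ k := fun h => apart (Or.inr rfl) (Or.inl h)
      have hjl : j ≠ l := fun h => apart (Or.inr rfl) (Or.inr h)
      have hm4 : m = i ∨ m = j ∨ m = k ∨ m = l := by omega
      have hm : m = k ∨ m = l := by
        rcases hm4 with h | h | h
        · exact absurd (Or.inl h) hmi
        · exact absurd (Or.inr h) hmi
        · exact h
      exact (mem_blowup_member_iff hdis hKB hxm).2 hm
    · intro hxb
      refine ⟨hPF _ hb hxb, fun hxa => ?_⟩
      have : x ∈ (K ∪ B i ∪ B j) ∩ (K ∪ B k ∪ B l) := mem_inter.2 ⟨hxa, hxb⟩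
      rw [← he] at this; exact notMem_empty _ this
  rw [heq]; exact hb

/-- **`AntichainMeetsOrJoins` holds**: a complement-free antichain `P ⊆ 2^F` has `#P ≤ #({∅} ∪ meets P)` or `#P ≤ #({F} ∪ joins P)`. [this work] -/
theorem antichainMeetsOrJoins_holds : AntichainMeetsOrJoins α := by
  intro F P hPF hcf hanti
  change #P ≤ #(insert ∅ (meets P)) ∨ #P ≤ #(insert F (joins P))
  by_contra hno
  rw [not_or, not_le, not_le] at hno
  obtain ⟨hm, hj⟩ := hno
  have v5 := two_mul_card_le_add_two P hanti
  have hm1 : #(meets P) ≤ #(insert ∅ (meets P)) := card_le_card (subset_insert _ _)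
  have hj1 : #(joins P) ≤ #(insert F (joins P)) := card_le_card (subset_insert _ _)
  -- both `∅ ∈ meets` and `F ∈ joins`, and `f = 2 #P - 2`
  have h0 : (∅ : Finset α) ∈ meets P := by
    by_contra h; rw [card_insert_of_notMem h] at hm; omega
  have hF : F ∈ joins P := by
    by_contra h; rw [card_insert_of_notMem h] at hj; omega
  rw [card_insert_of_mem h0] at hm
  rw [card_insert_of_mem hF] at hj
  -- case analysis on `#P`
  have hpos : 1 ≤ #(meets P) := card_pos.2 ⟨_, h0⟩
  by_cases h2 : #P ≤ 2
  · -- two members: a complementary pair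
    obtain ⟨a, ha, b, hb, hab, he⟩ := mem_meets_iff.1 h0
    obtain ⟨c, hc, d, hd, hcd, hu⟩ := mem_joins_iff.1 hF
    have hP : P = {a, b} := by
      symm; apply eq_of_subset_of_card_le
      · intro x hx; rcases mem_insert.1 hx with rfl | hx
        · exact ha
        · rw [mem_singleton.1 hx]; exact hb
      · rw [card_pair hab]; exact h2
    have memab : ∀ x ∈ P, x = a ∨ x = b := by
      intro x hx; rw [hP, mem_insert, mem_singleton] at hx; exact hx
    have hu' : a ∪ b = F := by
      rcases memab c hc with rfl | rfl <;> rcases memab d hd with rfl | rfl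
      · exact absurd rfl hcd
      · exact hu.symm
      · rw [union_comm]; exact hu.symm
      · exact absurd rfl hcd
    apply hcf a ha
    have : F \ a = b := by
      ext x; rw [mem_sdiff, ← hu']
      constructor
      · rintro ⟨hx, hxa⟩
        rcases mem_union.1 hx with h | h
        · exact absurd h hxa
        · exact h
      · intro hxb
        refine ⟨mem_union_right _ hxb, fun hxa => ?_⟩
        have : x ∈ a ∩ b := mem_inter.2 ⟨hxa, hxb⟩
        rw [← he] at this; exact notMem_empty _ this
    rw [this]; exact hb
  by_cases h3 : #P = 3
  · rcases three_members_trichotomy hanti h3 with ⟨K, hK⟩ | ⟨U, hU⟩ | h5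
    · have := card_meets_le_one_of_sunflower hK; omega
    · have := card_joins_le_one_of_cosunflower hU; omega
    · omega
  by_cases h4 : #P = 4
  · have := seven_le_of_card_eq_four hanti h4; omega
  by_cases h5 : #P = 5
  · have := ten_le_of_card_eq_five hanti h5; omega
  by_cases h6 : #P = 6
  · exact not_empty_top_of_six hPF hcf hanti h6 (by omega) h0 hF
  · have := two_mul_card_le_of_seven_le P hanti (by omega); omega

/-- **The rainbow lemma for complement-free antichains**: `#P ≤ #rainbowMeets F P`. [this work] -/
theorem card_le_card_rainbowMeets_of_antichain (F : Finset α) (P : Finset (Finset α)) (hPF : ∀ S ∈ P, S ⊆ F)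
    (hcf : ∀ S ∈ P, F \ S ∉ P) (hanti : IsAntichain (· ⊆ ·) (P : Set (Finset α))) : #P ≤ #(rainbowMeets F P) :=
  card_le_card_rainbowMeets_of_antichainMeetsOrJoins antichainMeetsOrJoins_holds F P hPF hcf hanti

end Summit.CriticalPhenomena.PercolationContinuityZ3.Theorems.SahiColouredDaykin
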